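import Summits.QuantumFields.YangMills.Theorems.FluctuationComparisonRegPrIntLS2BetaSourceRowEnergySplit
import HarnessLib

/-!
# S2β · (SCT″-c)₁ (SRC-E) piece (i) — «THE SOURCE COEFFICIENT IS PLAQUETTE-CLASS»: ✓p839415 `Bsrc_split_le`'s linear coefficient
# `c̄(i) := L·(L·(2δ(i)(L+2L+2))) + 48α(i)·L + 2ᾱp(i)·ℓ + 24α(i)·ℓ + 4·404·ℓ·α(i) + 2δ(i)·L²` is LINEAR in the three class letters, hence bounded by ONE class `θ`
# whenever `δ(i) ≤ θ`, `α(i) ≤ kα·θ`, `ᾱp(i) ≤ kp·θ`: `c̄(i) ≤ Γ(L,ℓ,kα,kp)·θ` and `c̄(i)² ≤ Γ²·θ²`, `Γ := 2L²(3L+2) + 2L² + (48L + 24ℓ + 1616ℓ)·kα + 2ℓ·kp` —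
# so the (BKG) decay of `θ_i = C_B·α·L^{2i}·L^{−2(K−J)}` passes to `c̄(i+1)²` (the class-decay letter (i) of px10's (SRC-E) SPEC, real algebra only)

Cell `ym3-torus` (YM ladder rung R3 = continuum `SU(2)` Yang–Mills on the three-torus at fixed lattice data — a RUNG: NOT d = 4, NOT infinite volume, NOT a mass gap,
NOT Clay).  Width seat «width 10» `ym3-torus-px10` (gen 26); crux `stmt-QuantumFields-20520`, LINE g18-1 S2β.  `--kind proof --supports stmt-QuantumFields-20520 --as helper`,
count-neutral, DEFINITION-FREE (0 `def`, 0 `instance`, 0 `notation`, 0 `sorry`, default heartbeats).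

WHAT IS PROVED (sorry-free).  ★★`srcCoeff_le_class` (`c̄ ≤ Γ·θ`), ★★`srcCoeff_sq_le_class_sq` (`c̄² ≤ Γ²·θ²`), with `c̄` in ✓`Bsrc_split_le`'s printed shape (the `((d+2)·L : ℕ)` cast for `ℓ`).
USE: with the station's (BKG) binder giving `θ_i`, the linear energy of ✓`Bsrc_split_le` is `≤ 3·Γ²·Σ_i w(i+1)·L^{K−J−2−i}·θ_i²·(4d²·Σ_b ‖X i b‖²)`, which (L2-TOWER) and the weights
`w_j := L^{K−J−1−j}` turn into a purse-share (px10 SPEC count 2026-09-01T00:49:48Z).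

HONEST SCOPE.  Real algebra; the class relations `δ ≤ θ`, `α ≤ kα·θ`, `ᾱp ≤ kp·θ` and (BKG) are HYPOTHESES of the consumer; nothing of Bałaban's renormalisation-group analysis is
asserted or proved ([Balaban1985Averaging] Prop. 4 (128)–(135) pp.37–38); GAP♯∘ (`stub_uniformFibreGapOrbit`, registry 3732b7df UNTOUCHED, 0∕5), S2β, the five registered stubs,
crux 20520, 19936, 19200 and `YM3TorusSU2` are NOT proved; no registered stub is closed; rung R3 — NOT d = 4, NOT infinite volume, NOT a mass gap, NOT Clay; the Yang–Mills mass
gap is NOT proved.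
-/

set_option autoImplicit false

namespace Summit.QuantumFields.YangMills.Theorems.FluctuationComparisonRegPrIntLS2BetaSourceCoeffClass

/-- ★★ **THE SOURCE COEFFICIENT IS ONE CLASS**: `c̄ ≤ Γ·θ` for `δ ≤ θ`, `α ≤ kα·θ`, `ᾱp ≤ kp·θ` (`L, ℓ ≥ 0`).
[cite: Balaban1985Averaging, Prop. 4 (128)-(135) pp.37-38] -/
theorem srcCoeff_le_class {L ℓ δ α αpb θ kα kp : ℝ} (hL : 0 ≤ L) (hℓ : 0 ≤ ℓ)
    (hδ : δ ≤ θ) (hα : α ≤ kα * θ) (hαp : αpb ≤ kp * θ) :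
    L * (L * (2 * δ * (L + 2 * L + 2))) + 48 * α * L + (2 * αpb * ℓ + 24 * α * ℓ) + 4 * (404 * ℓ * α) + 2 * δ * L ^ 2 ≤
      (2 * L ^ 2 * (3 * L + 2) + 2 * L ^ 2 + (48 * L + 24 * ℓ + 1616 * ℓ) * kα + 2 * ℓ * kp) * θ := by
  have h1 : L * (L * (2 * δ * (L + 2 * L + 2))) ≤ 2 * L ^ 2 * (3 * L + 2) * θ := by
    have : L * (L * (2 * δ * (L + 2 * L + 2))) = 2 * L ^ 2 * (3 * L + 2) * δ := by ring
    rw [this]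
    exact mul_le_mul_of_nonneg_left hδ (by positivity)
  have h2 : 48 * α * L ≤ 48 * L * kα * θ := by nlinarith [mul_le_mul_of_nonneg_left hα (show (0:ℝ) ≤ 48 * L by positivity)]
  have h3 : 2 * αpb * ℓ ≤ 2 * ℓ * kp * θ := by nlinarith [mul_le_mul_of_nonneg_left hαp (show (0:ℝ) ≤ 2 * ℓ by positivity)]
  have h4 : 24 * α * ℓ ≤ 24 * ℓ * kα * θ := by nlinarith [mul_le_mul_of_nonneg_left hα (show (0:ℝ) ≤ 24 * ℓ by positivity)]
  have h5 : 4 * (404 * ℓ * α) ≤ 1616 * ℓ * kα * θ := by nlinarith [mul_le_mul_of_nonneg_left hα (show (0:ℝ) ≤ 1616 * ℓ by positivity)]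
  have h6 : 2 * δ * L ^ 2 ≤ 2 * L ^ 2 * θ := by nlinarith [mul_le_mul_of_nonneg_left hδ (show (0:ℝ) ≤ 2 * L ^ 2 by positivity)]
  nlinarith [h1, h2, h3, h4, h5, h6]

/-- ★★ Squared: `c̄² ≤ Γ²·θ²` — the shape ✓`Bsrc_split_le`'s linear energy carries (`c̄(i+1)^2 * EM i`); with the `((d+2)·L : ℕ)` cast of `ℓ` as printed there.
[cite: Balaban1985Averaging, Prop. 4 (128)-(135) pp.37-38] -/
theorem srcCoeff_sq_le_class_sq {d Lnat : ℕ} {δ α αpb θ kα kp : ℝ}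
    (hδ : δ ≤ θ) (hα : α ≤ kα * θ) (hαp : αpb ≤ kp * θ) (hδ0 : 0 ≤ δ) (hα0 : 0 ≤ α) (hαp0 : 0 ≤ αpb) :
    ((Lnat : ℝ) * ((Lnat : ℝ) * (2 * δ * ((Lnat : ℝ) + 2 * Lnat + 2))) + 48 * α * (Lnat : ℝ) +
        (2 * αpb * ((((d + 2) * Lnat : ℕ)) : ℝ) + 24 * α * ((((d + 2) * Lnat : ℕ)) : ℝ)) +
        4 * (404 * ((((d + 2) * Lnat : ℕ)) : ℝ) * α) + 2 * δ * (Lnat : ℝ) ^ 2) ^ 2 ≤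
      (2 * (Lnat : ℝ) ^ 2 * (3 * Lnat + 2) + 2 * (Lnat : ℝ) ^ 2 + (48 * Lnat + 24 * ((((d + 2) * Lnat : ℕ)) : ℝ) + 1616 * ((((d + 2) * Lnat : ℕ)) : ℝ)) * kα +
        2 * ((((d + 2) * Lnat : ℕ)) : ℝ) * kp) ^ 2 * θ ^ 2 := by
  have hL : (0 : ℝ) ≤ (Lnat : ℝ) := Nat.cast_nonneg _
  have hℓ : (0 : ℝ) ≤ ((((d + 2) * Lnat : ℕ)) : ℝ) := Nat.cast_nonneg _
  have h := srcCoeff_le_class hL hℓ hδ hα hαp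
  have h0 : 0 ≤ (Lnat : ℝ) * ((Lnat : ℝ) * (2 * δ * ((Lnat : ℝ) + 2 * Lnat + 2))) + 48 * α * (Lnat : ℝ) +
        (2 * αpb * ((((d + 2) * Lnat : ℕ)) : ℝ) + 24 * α * ((((d + 2) * Lnat : ℕ)) : ℝ)) +
        4 * (404 * ((((d + 2) * Lnat : ℕ)) : ℝ) * α) + 2 * δ * (Lnat : ℝ) ^ 2 := by positivity
  rw [← mul_pow]
  exact pow_le_pow_left₀ h0 h 2

end Summit.QuantumFields.YangMills.Theorems.FluctuationComparisonRegPrIntLS2BetaSourceCoeffClass
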